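import Summits.BirchSwinnertonDyer.Rank1Residual.Additive.AdditiveTamagawaWitnessBaseChange
import Summits.BirchSwinnertonDyer.Rank1Residual.Additive.ZpTowerUnramifiedLayer
import HarnessLib

/-!
# The additive Tamagawa witness in the LAYERS `K_n` of a `ℤ_p`-extension: at every place `w` of
# `K_n = κ.layer n` above an additive Tamagawa place `v ∤ p` of `E/K` (`p` odd, `p ∣ c_v`), an
# unramified class of `H¹((K_n)_w, E[p])` outside the local Kummer image of `E_{K_n}`
# (cell `b2b-bsdres`, team n1011, seat p06 GEN 4; OWNERS row T-E3g-ADD, FILE H — the `hwit`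
# supplier of T-E3g-BUDn at the additive places, binder-free)

HONEST FRAMING (cell `b2b-bsdres`, run/shared/lean/b2b/bsd-rank1-residual/, verbatim in every
file): the goal of the cell is to DELETE the COMBINATION-SHAPED residual classes of the
Birch–Swinnerton-Dyer formula for ALL analytic-rank `≤ 1` elliptic curves over `ℚ` — "full BSD
formula for every rank `≤ 1` curve in class `C`" assembled STRICTLY from published theorems — so
that the rank-`≤ 1` remainder becomes exactly the CONSTRUCTION-SHAPED classes, which are TYPED
(missing-input `Prop`s), NOT attempted. This is not "finishing BSD". Team n1011 (N10/N11: X4 ∧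
`p = 3`): research routes on CONSTRUCTION-SHAPED classes; nothing is booked by this file.
THEOREMS ONLY: no definition, no named fact, nothing asserted.

## What (ROUTE-2 II.17.3 D-n.3 (add) at the layers; consumer: T-E3g-BUDn N2's `hwitn`)

`AdditiveTamagawaWitnessBaseChange` gave the witness over any finite Galois `M/K` at `w ∣ v` with
`e(v) = 1`; `ZpTowerUnramifiedLayer` proved `e(v, K_n/K) = 1` for `v ∤ p` in every layer
`K_n = κ.layer n` of a `ℤ_p`-extension `κ` (Washington 13.2). THIS FILE composes them: for an
elliptic curve `E` over a number field `K`, an odd prime `p`, a `ℤ_p`-extension `κ`, a layer `n`,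
an additive place `v ∤ p` of `E` with `p ∣ c_v(E/K)`, and ANY place `w` of `K_n` above `v`:

  `∃ u ∈ H¹_ur((K_n)_w, E[p]), u ∉ 𝓚_w`   for `E_{K_n}` at `w`

— with NO hypothesis left on the layer (the data are over `K`: `v ∤ p`, `p ≠ 2`, additive at `v`,
`p ∣ c_v`). At `K = ℚ`, `κ` cyclotomic this is the additive half of the `hwitn` input of the
level-`n` budget door (p10's skel/T-E3g-BUDn FILE N2), for every `n`.

References: R. Greenberg, LNM 1716 (1999) §2 p. 74, §5 (406D1 at `p = 5`: the level-1 door)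
[GreenbergLNM1716]; L. C. Washington, *Introduction to Cyclotomic Fields* Prop. 13.2
[Washington1997]; J. H. Silverman, *AEC* Prop. VII.5.4, Thm. VII.6.1 [SilvermanAEC2009].
-/

set_option autoImplicit false

noncomputable section

open scoped Classical

open NumberField IsDedekindDomain Field
open Literature.NumberTheory.EllipticCurves Literature.NumberTheory.GaloisRepresentations
  Literature.NumberTheory.GaloisRepresentations.IsNonarchimedeanLocalField
open Summit.BirchSwinnertonDyer.Rank1Residual.X11b

namespace Summit.BirchSwinnertonDyer.Rank1Residual.Additive

variable {K : Type} [Field K] [NumberField K] (W : WeierstrassCurve K) [W.IsElliptic] (p : ℕ)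
  [hp : Fact p.Prime] (κ : ZpExtension K p) (n : ℕ)
  {v : HeightOneSpectrum (𝓞 K)} {w : HeightOneSpectrum (𝓞 (κ.layer n))}

/-- **The additive Tamagawa witness at the layer `K_n`, from a nonzero `p`-torsion point of
`E(K_v)`** (`v ∤ p`, `p` odd, `E` additive at `v`, `w ∣ v` any place of `K_n = κ.layer n`).
[cite: Washington1997, Prop. 13.2] [cite: SilvermanAEC2009, Prop. VII.5.4 and Thm. VII.6.1] -/
theorem exists_mem_unramifiedSubgroup_not_mem_kummerLocalConditionAt_layer_of_point
    (hw : w.asIdeal.under (𝓞 K) = v.asIdeal) (hpv : ((p : ℕ) : 𝓞 K) ∉ v.asIdeal) (hp2 : p ≠ 2)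
    (hadd : W.HasAdditiveReductionAt v)
    {T : (W.baseChange (v.adicCompletion K)).toAffine.Point} (hT : T ≠ 0) (hpT : (p : ℤ) • T = 0) :
    ∃ u ∈ DiscreteGaloisModule.unramifiedSubgroup
        (GaloisRep.restrictField (w.adicCompletion (κ.layer n))
          ((W.baseChange (κ.layer n)).torsionGaloisModule (p : ℤ))) 1,
      u ∉ (W.baseChange (κ.layer n)).kummerLocalConditionAt (p : ℤ) (w.adicCompletion (κ.layer n)) :=
  exists_mem_unramifiedSubgroup_not_mem_kummerLocalConditionAt_baseChange_of_point W p (κ.layer n)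
    hw (ZpTower.ramificationIdxIn_layer_eq_one κ n hpv) hpv hp2 hadd hT hpT

/-- **The additive Tamagawa witness at the layer `K_n`** (ROUTE-2 II.17.3 D-n.3 (add), binder-free
on the layer): for `E/K`, `p` odd, a `ℤ_p`-extension `κ`, `n`, an additive place `v ∤ p` with
`p ∣ c_v(E/K)` and any place `w ∣ v` of `K_n = κ.layer n`:
`∃ u ∈ H¹_ur((K_n)_w, E[p]), u ∉ 𝓚_w` for `E_{K_n}` — the additive half of the `hwit` input of the
K-general level-`0` socket `exists_finset_layerZero_of_tamagawaWitnesses` at `K := K_n`,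
`W := E_{K_n}`. [cite: GreenbergLNM1716, §2 p. 74 and §5 (406D1)] [cite: Washington1997, Prop. 13.2]
[cite: SilvermanAEC2009, Prop. VII.5.4 and Thm. VII.6.1] -/
theorem exists_mem_unramifiedSubgroup_not_mem_kummerLocalConditionAt_layer_of_dvd_localTamagawaNumber
    (hw : w.asIdeal.under (𝓞 K) = v.asIdeal) (hpv : ((p : ℕ) : 𝓞 K) ∉ v.asIdeal) (hp2 : p ≠ 2)
    (hadd : W.HasAdditiveReductionAt v)
    (hc : p ∣ (W.baseChange (v.adicCompletion K)).localTamagawaNumber (v.adicCompletionIntegers K)) :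
    ∃ u ∈ DiscreteGaloisModule.unramifiedSubgroup
        (GaloisRep.restrictField (w.adicCompletion (κ.layer n))
          ((W.baseChange (κ.layer n)).torsionGaloisModule (p : ℤ))) 1,
      u ∉ (W.baseChange (κ.layer n)).kummerLocalConditionAt (p : ℤ) (w.adicCompletion (κ.layer n)) :=
  exists_mem_unramifiedSubgroup_not_mem_kummerLocalConditionAt_baseChange_of_dvd_localTamagawaNumber
    W p (κ.layer n) hw (ZpTower.ramificationIdxIn_layer_eq_one κ n hpv) hpv hp2 hadd hc

end Summit.BirchSwinnertonDyer.Rank1Residual.Additive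

end
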